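import Mathlib.Order.Filter.Germ.Basic
import Mathlib.Analysis.SpecificLimits.Basic
import Mathlib.Analysis.Convex.Function
import Mathlib.Data.Prod.Lex
import Mathlib.Algebra.Order.Group.Synonym
import HarnessLib

/-!
# Connes–Consani, *Geometry of the scaling site* (2017), §4.1–4.4 at the semiring level: the stalks
# `ℛ_H` and `𝒵_H` of the structure sheaf (Thm. 4.2), the points over `ℝ_max` (Lemma 4.4, the
# algebraic content of Thm. 4.3), `Frac ℛ_H` (Prop. 4.5), the order at a point (Def. 4.6,
# Prop. 4.7) — PROVED

Topic `Literature/NumberTheory/ConnesConsani`. Source: A. Connes, C. Consani, *Geometry of the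
scaling site*, Selecta Math. (N.S.) 23 (2017) 1803–1850 = arXiv:1603.03191 [bib
`ConnesConsani2017ScalingSite`], §4 "The structure sheaf of the scaling site and its stalks",
§4.1 "The stalks of the structure sheaf `𝒪`" (Thm. 4.2), §4.2 "The points of `𝒮` over `ℝ₊^max`"
(Thm. 4.3, Lemma 4.4), §4.3 "The sheaf of fractions and Cartier divisors" (Prop. 4.5, eqs.
(24)–(25)), §4.4 "The order at a point" (Def. 4.6, Prop. 4.7, eqs. (26)–(27)); arXiv pages
p0012–p0013. Companion of `ScalingSitePeriodicOrbit.lean` (the periodic orbits `C_p`, where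
Def. 4.6 appears in the coordinate `λ` as `cpOrder`) and of `ArithmeticSite.lean` (whose
`MaxPlusHom` renders the points of the arithmetic site over `ℝ₊^max` in the same additive
convention `ℝ_max = (ℝ ∪ {-∞}, max, +) = WithBot ℝ`).

## The statements, verbatim

* **Theorem 4.2.** "(i) At the point `𝔭_H` of the topos `[0,∞) ⋊ ℕ^×` associated to the rank one
  subgroup `H ⊂ ℝ` the stalk of the structure sheaf `𝒪` is the semiring `ℛ_H` of germs, at `λ = 1`,
  of `ℝ_max`-valued, piecewise affine convex functions `f(λ)` with slopes in `H`. (ii) The stalk of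
  the structure sheaf `𝒪` at the point `𝔮_H` of `[0,∞) ⋊ ℕ^×` associated to the abstract rank one
  ordered group `H` is the semiring `𝒵_H` associated by the max-plus construction to the totally
  ordered group `ℝ × H` and endowed with the lexicographic order." From the proof: "multiplication
  corresponds to `(x,h) • (x',h') = (x + x', h + h')` and the addition to `(x,h) ∨ (x',h') := (x,h)`
  if `x > x'`; `(x',h')` if `x' > x`; `(x, h ∨ h')` if `x = x'`." "Next, we describe the semiring
  `ℛ_H` […]. The germ of `f` is determined by the triple `(x,h₊,h₋)`, with `x ∈ ℝ` and `h_± ∈ H`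
  given by `x = f(1)`, `f(1 ± ε) = x ± h_± ε`, for `ε ≥ 0` small enough. The triples `(x,h₊,h₋)`
  obtained from elements of `ℛ_H` are characterized by the condition `h₊ ≥ h₋` which corresponds
  to the convexity of the function `f(1 ± ε) = x ± h_± ε` for `ε ≥ 0` small enough. The only other
  element of the semiring `ℛ_H` corresponds to the germ of the constant function `-∞`. This
  function plays the role of the 'zero' element […]. The 'addition' `∨` is given by the max
  between two germs and hence it is described by the formula `(x,h₊,h₋) ∨ (x',h'₊,h'₋) :=
  (x,h₊,h₋)` if `x > x'`; `(x',h'₊,h'₋)` if `x' > x`; `(x, h₊ ∨ h'₊, h₋ ∧ h'₋)` if `x = x'`."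
  (eqs. (22)–(23): "`D_±(f)(H) ∈ H`, `D₊(f)(H) ≥ D₋(f)(H)`".)
* **Theorem 4.3.** "The canonical projection from the set `𝒮(ℝ₊^max)` of the points of the scaling
  site `𝒮` defined over `ℝ₊^max` to the points of the topos `[0,∞) ⋊ ℕ^×` is bijective. The proof
  follows from the next Lemma." **Lemma 4.4.** "(i) The map `(x,h₊,h₋) ↦ x` is the only element of
  `Hom_{ℝ_max}(ℛ_H, ℝ_max)`. (ii) The map `(x,h₊) ↦ x` is the only element of
  `Hom_{ℝ_max}(𝒵_H, ℝ_max)`." (Proof of (i): "the `ℝ_max`-linearity shows that the image by `φ` of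
  the constant function is `φ(x,0,0) = x`. Then, we see that for any germ `f` which is not identical
  to `-∞`, there exists a constant function `g < f`. One then has `f ∨ g = f ⟹ φ(f) = φ(f ∨ g) =
  φ(f) ∨ φ(g) ⟹ φ(f) ≥ φ(g)`. This shows that one cannot have `φ(f) = -∞`. This argument shows
  that for any elements `f, g` of `ℛ_H`, one has `f < g ⟹ φ(f) ≤ φ(g)` and it follows that
  `x < x' ⟹ φ(x,h₊,h₋) ≤ φ(x',h'₊,h'₋)`. Then, since `φ(x,0,0) = x` one gets `φ(x,h₊,h₋) = x`.
  (ii) The proof is similar as for (i).")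
* **Proposition 4.5.** "The semiring `ℛ_H` […] is [multiplicatively cancellative] and its semifield
  of fractions `Frac ℛ_H` is the semifield of germs, at `λ = 1`, of `ℝ_max`-valued, piecewise
  affine, continuous functions `f(λ)` with slopes in `H` and endowed with the operations of the max
  and the addition of germs." (Proof: "`f + h = g + h` […] since these functions take finite values
  at every point we get `f = g`"; "`(x-y) ∨ (z-t) = ((x+t) ∨ (y+z)) - (y+t)`"; "The triples
  `(x,h₊,h₋)` obtained from elements of `Frac ℛ_H` correspond to arbitrary values of
  `(x,h₊,h₋) ∈ ℝ × H × H`"; the rules (24) `(x,h₊,h₋) ∨ (x',h'₊,h'₋)` as above and (25)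
  "`(x,h₊,h₋) • (x',h'₊,h'₋) := (x + x', h₊ + h'₊, h₋ + h'₋)`".)
* **Definition 4.6.** "Let `𝔭_H` be the point […] and let `f` be an element in the stalk of `𝒦` at
  `𝔭_H`. Then, the order of `f` at `H` is defined as `Ord(f) = h₊ - h₋ ∈ H ⊂ ℝ`, where
  `h_± = lim_{ε→0±} (f((1+ε)H) - f(H))/ε`." **Proposition 4.7.** "For any two elements `f, g` in
  the stalk of `𝒦` at `𝔭_H` one has `Ord(f ∨ g) ≥ Ord(f) ∧ Ord(g)` (26), `Ord(f + g) = Ord(f) + Ord(g)`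
  (27)."

## Rendering

* `ℝ_max = (ℝ ∪ {-∞}, max, +)` is `WithBot ℝ` with `⊔` and `+` (the additive convention of
  `ArithmeticSite.lean`; `ℝ_max ≅ ℝ₊^max` by `exp`). `H` is any additive subgroup of `ℝ` (the
  rank-one hypothesis plays no role in §4.1–4.4 beyond the topos). A non-zero germ is the triple
  `AffGerm H = (x, h₊, h₋)` (`hp`, `hm ∈ H`), representing the function
  `AffGerm.toFun : λ ↦ x + h₊(λ-1)` (`λ ≥ 1`), `x + h₋(λ-1)` (`λ ≤ 1`), i.e. `f(1 ± ε) = x ± h_± ε`,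
  with its germ `AffGerm.toGerm` in Mathlib's `Filter.Germ (𝓝 1) ℝ`; "the germ of `f` is determined
  by the triple" is `AffGerm.toGerm_injective`. The operations are (24) (`⊔`, `sup_of_lt/_gt/_eq`)
  and (25) (`+`), and they ARE the max and the sum of germs: `toGerm_sup`, `toGerm_add`
  (`toFun_sup`: the max of the two functions near `λ = 1` is given by (24)); the order is the
  eventual order of germs (`SemilatticeSup` transported along `toGerm`; `le_iff` in terms of
  triples). `ℛ_H ∖ {-∞}` = `ConvGerm H` (the triples with `h₊ ≥ h₋`, `AffGerm.IsConvex`;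
  `isConvex_iff_convexOn`: iff the represented function is convex), `ℛ_H = RStalk H :=
  WithBot (ConvGerm H)`, `Frac ℛ_H = KStalk H := WithBot (AffGerm H)`; `𝒵_H = ZStalk H :=
  WithBot (ℝ ×ₗ H)` (Mathlib's lexicographic product, `ZStalk.sup_def` = the printed `∨` rule,
  `ZStalk.coe_add` = the printed `•`). "`Hom_{ℝ_max}(–, ℝ_max)`": maps to `WithBot ℝ` preserving
  `∨` and the constants (`RStalk.const`, `ZStalk.const`) — exactly the two properties the printed
  proof uses (`ℝ_max`-linearity with `φ(1) = 1`, and additivity); the evaluations `RStalk.eval`,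
  `ZStalk.eval` moreover preserve `-∞` and `•` (`eval_bot`, `eval_add`).
* What is PROVED: **Thm. 4.2** (the algebra of the stalks as printed): `toGerm_injective`,
  `toGerm_sup`, `toGerm_add`, `isConvex_iff_convexOn`, `IsConvex.sup/.add` (so `ℛ_H` is closed
  under the operations), `ZStalk.sup_def`, `ZStalk.coe_add`; **Lemma 4.4 (i)**
  `ConnesConsani2017_lemma_4_4_i` (any `φ : ℛ_H → ℝ_max` with `φ(a ∨ b) = φ(a) ∨ φ(b)` and
  `φ(const c) = c` is the evaluation `(x,h₊,h₋) ↦ x`; proof as printed, through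
  `ConvGerm.const_lt_le`: `const(x-ε) ≤ (x,h₊,h₋) ≤ const(x+ε)`), `ConnesConsani2017_lemma_4_4_i_exists`
  (the evaluation is such a morphism), **(ii)** `ConnesConsani2017_lemma_4_4_ii`; **Prop. 4.5**
  `ConnesConsani2017_prop_4_5_cancel` (`f + h = g + h ⟹ f = g` in `ℛ_H`, `h ≠ -∞`),
  `ConnesConsani2017_prop_4_5_frac` (every triple is `g - k` with `g, k ∈ ℛ_H`),
  `ConnesConsani2017_prop_4_5_sup` (the `∨` of fractions, "`(x-y) ∨ (z-t) = ((x+t) ∨ (y+z)) - (y+t)`",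
  from `AffGerm.sup_add`); **Def. 4.6** `AffGerm.ord` with `ord_mem` (`∈ H`), `ord_nonneg_iff`
  (`Ord(f) ≥ 0 ⟺ f ∈ ℛ_H`); **Prop. 4.7** `ConnesConsani2017_prop_4_7_sup` (26),
  `ConnesConsani2017_prop_4_7_add` (27).
* NOT typed here: the topos `[0,∞) ⋊ ℕ^×`, its points `𝔭_H`, `𝔮_H` and the identification of the
  stalks of the sheaf `𝒪` with `ℛ_H`, `𝒵_H` (the colimit computation in the proof of Thm. 4.2), and
  Thm. 4.3 itself (points of the topos); only their semiring-level content above is formalised.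
-/
noncomputable section

open Set Filter Topology

namespace Literature.NumberTheory.ConnesConsani

variable {H : AddSubgroup ℝ}

/-! ## Germs at `λ = 1` of piecewise affine continuous functions with slopes in `H`: the triples `(x, h₊, h₋)` -/

/-- A germ at `λ = 1` of an `ℝ_max`-valued, piecewise affine, continuous function `f(λ)` with slopes
in `H`, not identically `-∞`: "The germ of `f` is determined by the triple `(x, h₊, h₋)`, with `x ∈ ℝ`
and `h_± ∈ H` given by `x = f(1)`, `f(1 ± ε) = x ± h_± ε`, for `ε ≥ 0` small enough." (These are
the non-zero elements of `Frac ℛ_H`, the stalk of `𝒦`; those of `ℛ_H` are the triples with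
`h₊ ≥ h₋`.) [cite: ConnesConsani2017ScalingSite, Thm. 4.2 (proof of (i)) and Prop. 4.5] -/
@[ext]
structure AffGerm (H : AddSubgroup ℝ) : Type where
  /-- the value `x = f(1)` -/
  x : ℝ
  /-- the right slope `h₊` -/
  hp : ℝ
  /-- the left slope `h₋` -/
  hm : ℝ
  /-- `h₊ ∈ H` -/
  hp_mem : hp ∈ H
  /-- `h₋ ∈ H` -/
  hm_mem : hm ∈ H

namespace AffGerm

/-- The piecewise affine function `f(1 ± ε) = x ± h_± ε` represented by the triple.
[cite: ConnesConsani2017ScalingSite, Thm. 4.2 (proof of (i))] -/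
def toFun (f : AffGerm H) (l : ℝ) : ℝ := f.x + (if 1 ≤ l then f.hp else f.hm) * (l - 1)

/-- The germ at `λ = 1` of the function represented by the triple. [cite: ConnesConsani2017ScalingSite, Thm. 4.2 (i) ("germs, at `λ = 1`")] -/
def toGerm (f : AffGerm H) : (𝓝 (1 : ℝ)).Germ ℝ := ↑f.toFun

/-- `f(1) = x`. [cite: ConnesConsani2017ScalingSite, Thm. 4.2 (proof of (i): "`x = f(1)`")] -/
@[simp] theorem toFun_one (f : AffGerm H) : f.toFun 1 = f.x := by simp [toFun]

/-- To the right of `1`: `f(λ) = x + h₊(λ - 1)`. [cite: ConnesConsani2017ScalingSite, Thm. 4.2 (proof of (i))] -/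
theorem toFun_of_one_le (f : AffGerm H) {l : ℝ} (hl : 1 ≤ l) : f.toFun l = f.x + f.hp * (l - 1) := by
  simp [toFun, hl]

/-- To the left of `1`: `f(λ) = x + h₋(λ - 1)`. [cite: ConnesConsani2017ScalingSite, Thm. 4.2 (proof of (i))] -/
theorem toFun_of_lt_one (f : AffGerm H) {l : ℝ} (hl : l < 1) : f.toFun l = f.x + f.hm * (l - 1) := by
  simp [toFun, not_le.2 hl]

/-- The represented function is continuous. [cite: ConnesConsani2017ScalingSite, Thm. 4.2 (i) ("continuous")] -/
theorem continuous_toFun (f : AffGerm H) : Continuous f.toFun := by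
  unfold toFun
  refine continuous_const.add ?_
  have : (fun l : ℝ => (if 1 ≤ l then f.hp else f.hm) * (l - 1)) =
      fun l => if (1 : ℝ) ≤ l then f.hp * (l - 1) else f.hm * (l - 1) := by
    funext l; split_ifs <;> rfl
  rw [this]
  exact Continuous.if_le (by fun_prop) (by fun_prop) continuous_const continuous_id
    (fun l hl => by rw [← hl]; simp)

/-- `f(λ) → x` as `λ → 1`. [cite: ConnesConsani2017ScalingSite, Thm. 4.2 (proof of (i))] -/
theorem tendsto_toFun (f : AffGerm H) : Tendsto f.toFun (𝓝 1) (𝓝 f.x) := by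
  have := f.continuous_toFun.tendsto 1
  rwa [toFun_one] at this

/-- **"The germ of `f` is determined by the triple `(x, h₊, h₋)`."** [cite: ConnesConsani2017ScalingSite, Thm. 4.2 (proof of (i))] -/
theorem toGerm_injective : Function.Injective (toGerm : AffGerm H → (𝓝 (1 : ℝ)).Germ ℝ) := by
  intro f g h
  have hfg : f.toFun =ᶠ[𝓝 1] g.toFun := Germ.coe_eq.1 h
  obtain ⟨ε, hε, hball⟩ := Metric.eventually_nhds_iff.1 hfg
  have h1 : f.x = g.x := by
    have := hball (y := 1) (by simpa using hε)
    simpa using this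
  have h2 : f.hp = g.hp := by
    have e := hball (y := 1 + ε / 2) (by simp [Real.dist_eq, abs_of_pos (half_pos hε)]; linarith)
    rw [toFun_of_one_le f (by linarith), toFun_of_one_le g (by linarith), h1] at e
    have : f.hp * (ε / 2) = g.hp * (ε / 2) := by linarith
    exact mul_right_cancel₀ (half_pos hε).ne' this
  have h3 : f.hm = g.hm := by
    have e := hball (y := 1 - ε / 2) (by simp [Real.dist_eq, abs_of_pos (half_pos hε)]; linarith)
    rw [toFun_of_lt_one f (by linarith), toFun_of_lt_one g (by linarith), h1] at e
    have : f.hm * (ε / 2) = g.hm * (ε / 2) := by linarith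
    exact mul_right_cancel₀ (half_pos hε).ne' this
  exact AffGerm.ext h1 h2 h3

/-- **The "addition" `∨`** of germs: "`(x,h₊,h₋) ∨ (x',h'₊,h'₋) := (x,h₊,h₋)` if `x > x'`;
`(x',h'₊,h'₋)` if `x' > x`; `(x, h₊ ∨ h'₊, h₋ ∧ h'₋)` if `x = x'`" (eq. (24)).
[cite: ConnesConsani2017ScalingSite, Thm. 4.2 (proof) and eq. (24)] -/
instance : Max (AffGerm H) :=
  ⟨fun f g => if f.x < g.x then g else if g.x < f.x then f else
    ⟨f.x, max f.hp g.hp, min f.hm g.hm, by rcases max_choice f.hp g.hp with h | h <;> rw [h] <;> simp [f.hp_mem, g.hp_mem],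
      by rcases min_choice f.hm g.hm with h | h <;> rw [h] <;> simp [f.hm_mem, g.hm_mem]⟩⟩

/-- **The "product" `•`** of germs (sum of functions): "`(x,h₊,h₋) • (x',h'₊,h'₋) := (x + x', h₊ + h'₊, h₋ + h'₋)`"
(eq. (25)); written `+`. [cite: ConnesConsani2017ScalingSite, eq. (25)] -/
instance : Add (AffGerm H) :=
  ⟨fun f g => ⟨f.x + g.x, f.hp + g.hp, f.hm + g.hm, H.add_mem f.hp_mem g.hp_mem, H.add_mem f.hm_mem g.hm_mem⟩⟩

/-- The rule (24), case `x > x'`. [cite: ConnesConsani2017ScalingSite, eq. (24)] -/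
theorem sup_of_lt {f g : AffGerm H} (h : g.x < f.x) : f ⊔ g = f := by
  show (if f.x < g.x then g else _) = f
  rw [if_neg (not_lt.2 h.le), if_pos h]

/-- The rule (24), case `x' > x`. [cite: ConnesConsani2017ScalingSite, eq. (24)] -/
theorem sup_of_gt {f g : AffGerm H} (h : f.x < g.x) : f ⊔ g = g := by
  show (if f.x < g.x then g else _) = g
  rw [if_pos h]

/-- The rule (24), case `x = x'`: `(x, h₊ ∨ h'₊, h₋ ∧ h'₋)`. [cite: ConnesConsani2017ScalingSite, eq. (24)] -/
theorem sup_of_eq {f g : AffGerm H} (h : f.x = g.x) :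
    f ⊔ g = ⟨f.x, max f.hp g.hp, min f.hm g.hm,
      by rcases max_choice f.hp g.hp with e | e <;> rw [e] <;> simp [f.hp_mem, g.hp_mem],
      by rcases min_choice f.hm g.hm with e | e <;> rw [e] <;> simp [f.hm_mem, g.hm_mem]⟩ := by
  show (if f.x < g.x then g else _) = _
  rw [if_neg (by rw [h]; exact lt_irrefl _), if_neg (by rw [h]; exact lt_irrefl _)]

/-- (25), value: `x + x'`. [cite: ConnesConsani2017ScalingSite, eq. (25)] -/
@[simp] theorem add_x (f g : AffGerm H) : (f + g).x = f.x + g.x := rfl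
/-- (25), right slope: `h₊ + h'₊`. [cite: ConnesConsani2017ScalingSite, eq. (25)] -/
@[simp] theorem add_hp (f g : AffGerm H) : (f + g).hp = f.hp + g.hp := rfl
/-- (25), left slope: `h₋ + h'₋`. [cite: ConnesConsani2017ScalingSite, eq. (25)] -/
@[simp] theorem add_hm (f g : AffGerm H) : (f + g).hm = f.hm + g.hm := rfl

/-- `(f ∨ g)(1) = f(1) ∨ g(1)`. [cite: ConnesConsani2017ScalingSite, eq. (24)] -/
theorem sup_x (f g : AffGerm H) : (f ⊔ g).x = max f.x g.x := by
  rcases lt_trichotomy f.x g.x with h | h | h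
  · rw [sup_of_gt h, max_eq_right h.le]
  · rw [sup_of_eq h, h, max_self]
  · rw [sup_of_lt h, max_eq_left h.le]

/-- **The product of germs is the sum of the functions.** [cite: ConnesConsani2017ScalingSite, eq. (25) ("given by the sum of the two germs")] -/
theorem toFun_add (f g : AffGerm H) : (f + g).toFun = f.toFun + g.toFun := by
  funext l
  simp only [toFun, Pi.add_apply, add_x, add_hp, add_hm]
  split_ifs <;> ring

/-- `toGerm (f • g) = toGerm f + toGerm g`. [cite: ConnesConsani2017ScalingSite, eq. (25)] -/
theorem toGerm_add (f g : AffGerm H) : (f + g).toGerm = f.toGerm + g.toGerm := by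
  rw [toGerm, toFun_add]; rfl

/-- **The addition of germs is the pointwise max near `λ = 1`.** [cite: ConnesConsani2017ScalingSite, Thm. 4.2 (proof: "The 'addition' `∨` is given by the max between two germs and hence it is described by the formula" (24))] -/
theorem toFun_sup (f g : AffGerm H) : (f ⊔ g).toFun =ᶠ[𝓝 1] fun l => max (f.toFun l) (g.toFun l) := by
  rcases lt_trichotomy f.x g.x with h | h | h
  · rw [sup_of_gt h]
    filter_upwards [f.tendsto_toFun.eventually_lt g.tendsto_toFun h] with l hl
    rw [max_eq_right hl.le]
  · rw [sup_of_eq h]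
    refine Eventually.of_forall fun l => ?_
    beta_reduce
    by_cases hl : 1 ≤ l
    · rw [toFun_of_one_le _ hl, toFun_of_one_le _ hl, toFun_of_one_le _ hl]
      dsimp only
      rw [← h, max_add_add_left, max_mul_of_nonneg _ _ (sub_nonneg.2 hl)]
    · push Not at hl
      rw [toFun_of_lt_one _ hl, toFun_of_lt_one _ hl, toFun_of_lt_one _ hl]
      dsimp only
      rw [← h, max_add_add_left]
      congr 1
      have hneg : l - 1 ≤ 0 := by linarith
      rcases le_total f.hm g.hm with hfg | hfg
      · rw [min_eq_left hfg, max_eq_left (mul_le_mul_of_nonpos_right hfg hneg)]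
      · rw [min_eq_right hfg, max_eq_right (mul_le_mul_of_nonpos_right hfg hneg)]
  · rw [sup_of_lt h]
    filter_upwards [g.tendsto_toFun.eventually_lt f.tendsto_toFun h] with l hl
    rw [max_eq_left hl.le]

/-- `toGerm (f ∨ g) = toGerm f ⊔ toGerm g`. [cite: ConnesConsani2017ScalingSite, Thm. 4.2 (proof) and eq. (24)] -/
theorem toGerm_sup (f g : AffGerm H) : (f ⊔ g).toGerm = f.toGerm ⊔ g.toGerm := by
  rw [toGerm, Germ.coe_eq.2 (toFun_sup f g)]; rfl

/-- Germs are ordered by eventual `≤` near `λ = 1`. [cite: ConnesConsani2017ScalingSite, Thm. 4.2 (i) and Lemma 4.4 (proof: "`f < g`")] -/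
instance : LE (AffGerm H) := ⟨fun f g => f.toGerm ≤ g.toGerm⟩
/-- Strict order of germs. [cite: ConnesConsani2017ScalingSite, Lemma 4.4 (proof: "`f < g ⟹ φ(f) ≤ φ(g)`")] -/
instance : LT (AffGerm H) := ⟨fun f g => f.toGerm < g.toGerm⟩

/-- The germs form a semilattice under `∨` = pointwise max of germs (ordered by eventual `≤` near
`λ = 1`). [cite: ConnesConsani2017ScalingSite, Thm. 4.2 (i) and eq. (24)] -/
instance : SemilatticeSup (AffGerm H) :=
  Function.Injective.semilatticeSup toGerm toGerm_injective Iff.rfl Iff.rfl toGerm_sup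

/-- The order in terms of triples: `f ≤ g` iff `x < x'`, or `x = x'`, `h₊ ≤ h'₊` and `h'₋ ≤ h₋`.
[cite: ConnesConsani2017ScalingSite, eq. (24)] -/
theorem le_iff {f g : AffGerm H} : f ≤ g ↔ f.x < g.x ∨ (f.x = g.x ∧ f.hp ≤ g.hp ∧ g.hm ≤ f.hm) := by
  rw [← sup_eq_right]
  rcases lt_trichotomy f.x g.x with h | h | h
  · simp only [sup_of_gt h, h, true_or]
  · rw [sup_of_eq h]
    constructor
    · intro e
      have e1 := congrArg AffGerm.hp e
      have e2 := congrArg AffGerm.hm e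
      simp only at e1 e2
      exact Or.inr ⟨h, by rw [← e1]; exact le_max_left _ _, by rw [← e2]; exact min_le_left _ _⟩
    · rintro (h' | ⟨-, h1, h2⟩)
      · exact absurd h h'.ne
      · exact AffGerm.ext h (max_eq_right h1) (min_eq_right h2)
  · rw [sup_of_lt h]
    constructor
    · intro e; rw [e] at h; exact absurd h (lt_irrefl _)
    · rintro (h' | ⟨h', -⟩)
      · exact absurd (h.trans h') (lt_irrefl _)
      · rw [h'] at h; exact absurd h (lt_irrefl _)

/-- Distributivity `(f ∨ g) • k = (f • k) ∨ (g • k)` ("translation invariance of `∨`").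
[cite: ConnesConsani2017ScalingSite, Prop. 4.5 (proof: "obtained from translation invariance of `∨`")] -/
theorem sup_add (f g k : AffGerm H) : (f ⊔ g) + k = (f + k) ⊔ (g + k) := by
  rcases lt_trichotomy f.x g.x with h | h | h
  · rw [sup_of_gt h, sup_of_gt (show (f + k).x < (g + k).x by simp only [add_x]; linarith)]
  · rw [sup_of_eq h, sup_of_eq (show (f + k).x = (g + k).x by simp only [add_x, h])]
    exact AffGerm.ext rfl (max_add_add_right _ _ _).symm (min_add_add_right _ _ _).symm
  · rw [sup_of_lt h, sup_of_lt (show (g + k).x < (f + k).x by simp only [add_x]; linarith)]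

/-- The unit germ `(0,0,0)` of `•` (the constant function `0 = 1_{ℝ_max}`). [cite: ConnesConsani2017ScalingSite, eq. (25)] -/
instance : Zero (AffGerm H) := ⟨⟨0, 0, 0, H.zero_mem, H.zero_mem⟩⟩

/-- Commutativity and associativity of `•`. [cite: ConnesConsani2017ScalingSite, eq. (25)] -/
instance : AddCommMonoid (AffGerm H) where
  add := (· + ·)
  add_assoc f g k := AffGerm.ext (add_assoc _ _ _) (add_assoc _ _ _) (add_assoc _ _ _)
  zero := 0
  zero_add f := AffGerm.ext (zero_add _) (zero_add _) (zero_add _)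
  add_zero f := AffGerm.ext (add_zero _) (add_zero _) (add_zero _)
  add_comm f g := AffGerm.ext (add_comm _ _) (add_comm _ _) (add_comm _ _)
  nsmul := nsmulRec

/-- The unit germ `(0, 0, 0)` has value `0`. [cite: ConnesConsani2017ScalingSite, eq. (25)] -/
@[simp] theorem zero_x : (0 : AffGerm H).x = 0 := rfl
/-- The unit germ has right slope `0`. [cite: ConnesConsani2017ScalingSite, eq. (25)] -/
@[simp] theorem zero_hp : (0 : AffGerm H).hp = 0 := rfl
/-- The unit germ has left slope `0`. [cite: ConnesConsani2017ScalingSite, eq. (25)] -/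
@[simp] theorem zero_hm : (0 : AffGerm H).hm = 0 := rfl

/-- The germ of the constant function `c`: `(c, 0, 0)`. [cite: ConnesConsani2017ScalingSite, Lemma 4.4 (proof: "the constant function […] `φ(x,0,0) = x`")] -/
def const (c : ℝ) : AffGerm H := ⟨c, 0, 0, H.zero_mem, H.zero_mem⟩

/-- `const c = (c, 0, 0)`: value. [cite: ConnesConsani2017ScalingSite, Lemma 4.4 (proof: "`φ(x,0,0) = x`")] -/
@[simp] theorem const_x (c : ℝ) : (const c : AffGerm H).x = c := rfl
/-- `const c = (c, 0, 0)`: right slope. [cite: ConnesConsani2017ScalingSite, Lemma 4.4 (proof)] -/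
@[simp] theorem const_hp (c : ℝ) : (const c : AffGerm H).hp = 0 := rfl
/-- `const c = (c, 0, 0)`: left slope. [cite: ConnesConsani2017ScalingSite, Lemma 4.4 (proof)] -/
@[simp] theorem const_hm (c : ℝ) : (const c : AffGerm H).hm = 0 := rfl

/-- Convexity of the germ: "The triples `(x,h₊,h₋)` obtained from elements of `ℛ_H` are
characterized by the condition `h₊ ≥ h₋` which corresponds to the convexity of the function
`f(1 ± ε) = x ± h_± ε` for `ε ≥ 0` small enough" (eq. (23): `D₊(f)(H) ≥ D₋(f)(H)`).
[cite: ConnesConsani2017ScalingSite, Thm. 4.2 (proof of (i)) and eq. (23)] -/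
def IsConvex (f : AffGerm H) : Prop := f.hm ≤ f.hp

/-- `h₊ ≥ h₋` iff the represented function is convex. [cite: ConnesConsani2017ScalingSite, Thm. 4.2 (proof of (i): "corresponds to the convexity of the function")] -/
theorem isConvex_iff_convexOn (f : AffGerm H) : f.IsConvex ↔ ConvexOn ℝ univ f.toFun := by
  constructor
  · intro hc
    -- `f` is the max of the two affine functions `x + h₊(λ-1)` and `x + h₋(λ-1)`
    have hrepr : f.toFun = (fun l => f.x + f.hp * (l - 1)) ⊔ fun l => f.x + f.hm * (l - 1) := by
      funext l
      simp only [Pi.sup_apply]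
      by_cases hl : 1 ≤ l
      · rw [toFun_of_one_le _ hl, max_eq_left]
        have := mul_le_mul_of_nonneg_right hc (sub_nonneg.2 hl)
        linarith
      · push Not at hl
        rw [toFun_of_lt_one _ hl, max_eq_right]
        have := mul_le_mul_of_nonpos_right hc (by linarith : l - 1 ≤ 0)
        linarith
    have haff : ∀ c : ℝ, ConvexOn ℝ univ fun l : ℝ => f.x + c * (l - 1) := fun c =>
      ⟨convex_univ, fun a _ b _ s t _ _ hst => by
        simp only [smul_eq_mul]
        exact le_of_eq (by rw [show t = 1 - s by linarith]; ring)⟩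
    rw [hrepr]
    exact (haff f.hp).sup (haff f.hm)
  · intro hconv
    by_contra hc
    unfold IsConvex at hc
    push Not at hc
    -- midpoint of `1 - 1` and `1 + 1`
    have key := hconv.2 (mem_univ (1 - 1 : ℝ)) (mem_univ (1 + 1 : ℝ)) (show (0 : ℝ) ≤ 1 / 2 by norm_num)
      (show (0 : ℝ) ≤ 1 / 2 by norm_num) (show (1 : ℝ) / 2 + 1 / 2 = 1 by norm_num)
    simp only [smul_eq_mul] at key
    rw [show (1 : ℝ) / 2 * (1 - 1) + 1 / 2 * (1 + 1) = 1 by norm_num, toFun_one,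
      toFun_of_lt_one _ (by norm_num), toFun_of_one_le _ (by norm_num)] at key
    linarith

/-- Convex germs are closed under `∨`. [cite: ConnesConsani2017ScalingSite, Thm. 4.2 (i) (`ℛ_H` is a semiring)] -/
theorem IsConvex.sup {f g : AffGerm H} (hf : f.IsConvex) (hg : g.IsConvex) : (f ⊔ g).IsConvex := by
  rcases lt_trichotomy f.x g.x with h | h | h
  · rw [sup_of_gt h]; exact hg
  · rw [sup_of_eq h]
    exact (min_le_left _ _).trans (hf.trans (le_max_left _ _))
  · rw [sup_of_lt h]; exact hf

/-- Convex germs are closed under `•`. [cite: ConnesConsani2017ScalingSite, Thm. 4.2 (i) (`ℛ_H` is a semiring)] -/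
theorem IsConvex.add {f g : AffGerm H} (hf : f.IsConvex) (hg : g.IsConvex) : (f + g).IsConvex :=
  add_le_add hf hg

/-- Constants are convex. [cite: ConnesConsani2017ScalingSite, Lemma 4.4 (proof)] -/
theorem isConvex_const (c : ℝ) : (const c : AffGerm H).IsConvex := le_rfl

/-- **Definition 4.6**: "the order of `f` at `H` is defined as `Ord(f) = h₊ - h₋ ∈ H ⊂ ℝ`, where
`h_± = lim_{ε → 0±} (f((1+ε)H) - f(H))/ε`." [cite: ConnesConsani2017ScalingSite, Def. 4.6] -/
def ord (f : AffGerm H) : ℝ := f.hp - f.hm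

/-- `Ord(f) ∈ H`. [cite: ConnesConsani2017ScalingSite, Def. 4.6 ("`∈ H ⊂ ℝ`")] -/
theorem ord_mem (f : AffGerm H) : f.ord ∈ H := H.sub_mem f.hp_mem f.hm_mem

/-- `Ord(f) ≥ 0 ⟺ f ∈ ℛ_H`. [cite: ConnesConsani2017ScalingSite, Def. 4.6 and eq. (23)] -/
theorem ord_nonneg_iff (f : AffGerm H) : 0 ≤ f.ord ↔ f.IsConvex := sub_nonneg

/-- **Prop. 4.7, eq. (26)**: "`Ord(f ∨ g) ≥ Ord(f) ∧ Ord(g)`". [cite: ConnesConsani2017ScalingSite, Prop. 4.7 eq. (26)] -/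
theorem ConnesConsani2017_prop_4_7_sup (f g : AffGerm H) : min f.ord g.ord ≤ (f ⊔ g).ord := by
  unfold ord
  rcases lt_trichotomy f.x g.x with h | h | h
  · rw [sup_of_gt h]; exact min_le_right _ _
  · rw [sup_of_eq h]
    simp only
    -- `(a ∨ b) - (c ∧ d) ≥ (a - c) ∧ (b - d)`
    have h1 := le_max_left f.hp g.hp
    have h2 := min_le_left f.hm g.hm
    have : f.hp - f.hm ≤ max f.hp g.hp - min f.hm g.hm := by linarith
    exact (min_le_left _ _).trans this
  · rw [sup_of_lt h]; exact min_le_left _ _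

/-- **Prop. 4.7, eq. (27)**: "`Ord(f + g) = Ord(f) + Ord(g)`" (the `+` of `ℝ_max`-valued functions is
the product `•` of germs). [cite: ConnesConsani2017ScalingSite, Prop. 4.7 eq. (27)] -/
theorem ConnesConsani2017_prop_4_7_add (f g : AffGerm H) : (f + g).ord = f.ord + g.ord := by
  unfold ord; simp only [add_hp, add_hm]; ring

end AffGerm

/-! ## The stalks `ℛ_H ⊂ Frac ℛ_H` (Thm. 4.2 (i), Prop. 4.5) -/

/-- The non-zero elements of `ℛ_H`: convex germs, `h₊ ≥ h₋`. [cite: ConnesConsani2017ScalingSite, Thm. 4.2 (proof of (i))] -/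
abbrev ConvGerm (H : AddSubgroup ℝ) : Type := {f : AffGerm H // f.IsConvex}

namespace ConvGerm

/-- The product on `ℛ_H ∖ {-∞}`. [cite: ConnesConsani2017ScalingSite, eq. (25)] -/
instance : Add (ConvGerm H) := ⟨fun f g => ⟨f.1 + g.1, f.2.add g.2⟩⟩

/-- `ℛ_H ∖ {-∞}` is a sub-semilattice of the germs. [cite: ConnesConsani2017ScalingSite, Thm. 4.2 (i)] -/
instance : SemilatticeSup (ConvGerm H) := Subtype.semilatticeSup fun _ _ hf hg => hf.sup hg

/-- `∨` in `ℛ_H` is that of the germs. [cite: ConnesConsani2017ScalingSite, Thm. 4.2 (i)] -/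
@[simp] theorem coe_sup (f g : ConvGerm H) : (f ⊔ g).1 = f.1 ⊔ g.1 := rfl
/-- `•` in `ℛ_H` is that of the germs. [cite: ConnesConsani2017ScalingSite, Thm. 4.2 (i)] -/
@[simp] theorem coe_add (f g : ConvGerm H) : (f + g).1 = f.1 + g.1 := rfl

/-- The constant germ `c` in `ℛ_H`. [cite: ConnesConsani2017ScalingSite, Lemma 4.4 (proof)] -/
def const (c : ℝ) : ConvGerm H := ⟨AffGerm.const c, AffGerm.isConvex_const c⟩

/-- The constant germ as a triple. [cite: ConnesConsani2017ScalingSite, Lemma 4.4 (proof)] -/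
@[simp] theorem coe_const (c : ℝ) : (const c : ConvGerm H).1 = AffGerm.const c := rfl

end ConvGerm

/-- **`ℛ_H`, the stalk of `𝒪` at `𝔭_H`** (Thm. 4.2 (i)): the convex germs together with "the germ of
the constant function `-∞`" which "plays the role of the 'zero' element" (`⊥`); addition `⊔`,
product `+`. [cite: ConnesConsani2017ScalingSite, Thm. 4.2 (i)] -/
abbrev RStalk (H : AddSubgroup ℝ) : Type := WithBot (ConvGerm H)

/-- **`Frac ℛ_H`, the stalk of `𝒦` at `𝔭_H`** (Prop. 4.5): all triples `(x,h₊,h₋)` and `-∞`.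
[cite: ConnesConsani2017ScalingSite, Prop. 4.5] -/
abbrev KStalk (H : AddSubgroup ℝ) : Type := WithBot (AffGerm H)

/-- The evaluation `(x, h₊, h₋) ↦ x`, `-∞ ↦ -∞`: `ℛ_H → ℝ_max`. [cite: ConnesConsani2017ScalingSite, Lemma 4.4 (i)] -/
def RStalk.eval : RStalk H → WithBot ℝ := WithBot.map fun f => f.1.x

/-- The constants `ℝ_max → ℛ_H`. [cite: ConnesConsani2017ScalingSite, Lemma 4.4 (proof: "`ℝ_max`-linearity")] -/
def RStalk.const : WithBot ℝ → RStalk H := WithBot.map ConvGerm.const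

/-- `eval` preserves `∨`. [cite: ConnesConsani2017ScalingSite, Lemma 4.4 (i) (evaluation is a morphism)] -/
theorem RStalk.eval_sup (a b : RStalk H) : RStalk.eval (a ⊔ b) = RStalk.eval a ⊔ RStalk.eval b := by
  induction a using WithBot.recBotCoe with
  | bot => simp [RStalk.eval]
  | coe f =>
    induction b using WithBot.recBotCoe with
    | bot => simp [RStalk.eval]
    | coe g =>
      simp only [RStalk.eval, ← WithBot.coe_sup, WithBot.map_coe, ConvGerm.coe_sup, AffGerm.sup_x]

/-- `eval` preserves the product. [cite: ConnesConsani2017ScalingSite, Lemma 4.4 (i) (evaluation is a morphism)] -/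
theorem RStalk.eval_add (a b : RStalk H) : RStalk.eval (a + b) = RStalk.eval a + RStalk.eval b := by
  induction a using WithBot.recBotCoe with
  | bot => simp [RStalk.eval]
  | coe f =>
    induction b using WithBot.recBotCoe with
    | bot => simp [RStalk.eval]
    | coe g =>
      simp only [RStalk.eval, ← WithBot.coe_add, WithBot.map_coe, ConvGerm.coe_add, AffGerm.add_x]

/-- `eval` is the identity on constants (`ℝ_max`-linearity and `eval(1) = 1`). [cite: ConnesConsani2017ScalingSite, Lemma 4.4 (proof)] -/
@[simp] theorem RStalk.eval_const (c : WithBot ℝ) : RStalk.eval (RStalk.const c : RStalk H) = c := by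
  induction c using WithBot.recBotCoe with
  | bot => rfl
  | coe c => rfl

/-- `eval(-∞) = -∞`. [cite: ConnesConsani2017ScalingSite, Lemma 4.4 (i)] -/
@[simp] theorem RStalk.eval_bot : RStalk.eval (⊥ : RStalk H) = ⊥ := rfl

/-- In `ℛ_H`: `const(x - ε) ≤ (x,h₊,h₋) ≤ const(x + ε)` for `ε > 0` ("for any germ `f` which is not
identical to `-∞`, there exists a constant function `g < f`"). [cite: ConnesConsani2017ScalingSite, Lemma 4.4 (proof)] -/
theorem ConvGerm.const_lt_le (f : ConvGerm H) {ε : ℝ} (hε : 0 < ε) :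
    ConvGerm.const (f.1.x - ε) ≤ f ∧ f ≤ ConvGerm.const (f.1.x + ε) := by
  constructor
  · show AffGerm.const (f.1.x - ε) ≤ f.1
    exact AffGerm.le_iff.2 (Or.inl (by simp; linarith))
  · show f.1 ≤ AffGerm.const (f.1.x + ε)
    exact AffGerm.le_iff.2 (Or.inl (by simp; linarith))

/-- **Connes–Consani 2017, Lemma 4.4 (i)**: "The map `(x, h₊, h₋) ↦ x` is the only element of
`Hom_{ℝ_max}(ℛ_H, ℝ_max)`." Rendered: any map `φ : ℛ_H → ℝ_max` compatible with `∨` and equal to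
the identity on the constants (`ℝ_max`-linearity, as used in the printed proof: "the
`ℝ_max`-linearity shows that the image by `φ` of the constant function is `φ(x,0,0) = x`") is the
evaluation; the proof is the printed one ("`f ∨ g = f ⟹ φ(f) ≥ φ(g)` […] `x < x' ⟹ φ(x,h₊,h₋) ≤
φ(x',h'₊,h'₋)` […] since `φ(x,0,0) = x` one gets `φ(x,h₊,h₋) = x`").
[cite: ConnesConsani2017ScalingSite, Lemma 4.4 (i)] -/
theorem ConnesConsani2017_lemma_4_4_i (φ : RStalk H → WithBot ℝ)
    (hsup : ∀ a b, φ (a ⊔ b) = φ a ⊔ φ b) (hconst : ∀ c : ℝ, φ (RStalk.const c) = c) :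
    φ = RStalk.eval := by
  have hmono : ∀ a b : RStalk H, a ≤ b → φ a ≤ φ b := fun a b hab => by
    rw [← sup_eq_right.2 hab, hsup]; exact le_sup_left
  funext a
  induction a using WithBot.recBotCoe with
  | bot =>
    -- `φ(-∞) ≤ c` for every real `c`
    rw [RStalk.eval_bot]
    by_contra hne
    obtain ⟨y, hy⟩ := WithBot.ne_bot_iff_exists.1 hne
    have := hmono ⊥ (RStalk.const ((y - 1 : ℝ) : WithBot ℝ)) bot_le
    rw [hconst, ← hy, WithBot.coe_le_coe] at this
    linarith
  | coe f =>
    show φ f = (f.1.x : WithBot ℝ)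
    have hbounds : ∀ ε : ℝ, 0 < ε → ((f.1.x - ε : ℝ) : WithBot ℝ) ≤ φ f ∧ φ f ≤ ((f.1.x + ε : ℝ) : WithBot ℝ) := by
      intro ε hε
      obtain ⟨h1, h2⟩ := f.const_lt_le hε
      exact ⟨by rw [← hconst]; exact hmono _ _ (WithBot.coe_le_coe.2 h1),
        by rw [← hconst]; exact hmono _ _ (WithBot.coe_le_coe.2 h2)⟩
    have hne : φ f ≠ ⊥ := fun h0 => by
      have := (hbounds 1 one_pos).1; rw [h0] at this; exact WithBot.not_coe_le_bot _ this
    obtain ⟨y, hy⟩ := WithBot.ne_bot_iff_exists.1 hne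
    rw [← hy]
    congr 1
    by_contra hyx
    rcases lt_or_gt_of_ne hyx with hlt | hlt
    · have := (hbounds ((f.1.x - y) / 2) (by linarith)).1
      rw [← hy, WithBot.coe_le_coe] at this
      linarith
    · have := (hbounds ((y - f.1.x) / 2) (by linarith)).2
      rw [← hy, WithBot.coe_le_coe] at this
      linarith

/-- The evaluation itself is such a morphism (existence part of Lemma 4.4 (i)): it preserves `-∞`,
`∨`, the product and the constants. [cite: ConnesConsani2017ScalingSite, Lemma 4.4 (i)] -/
theorem ConnesConsani2017_lemma_4_4_i_exists :
    (∀ a b : RStalk H, RStalk.eval (a ⊔ b) = RStalk.eval a ⊔ RStalk.eval b) ∧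
      (∀ a b : RStalk H, RStalk.eval (a + b) = RStalk.eval a + RStalk.eval b) ∧
      (∀ c : WithBot ℝ, RStalk.eval (RStalk.const c : RStalk H) = c) :=
  ⟨RStalk.eval_sup, RStalk.eval_add, RStalk.eval_const⟩

/-- **Prop. 4.5, first part**: "`ℛ_H` is [multiplicatively cancellative]: one considers an equation
of the form `f + h = g + h` for `f, g, h ∈ ℛ_H` and notice that since these functions take finite
values at every point we get `f = g`." [cite: ConnesConsani2017ScalingSite, Prop. 4.5 (proof)] -/
theorem ConnesConsani2017_prop_4_5_cancel (f g : RStalk H) (k : ConvGerm H) (h : f + ↑k = g + ↑k) : f = g := by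
  induction f using WithBot.recBotCoe with
  | bot =>
    induction g using WithBot.recBotCoe with
    | bot => rfl
    | coe g => exact absurd h (by rw [WithBot.bot_add, ← WithBot.coe_add]; exact WithBot.bot_ne_coe)
  | coe f =>
    induction g using WithBot.recBotCoe with
    | bot => exact absurd h (by rw [WithBot.bot_add, ← WithBot.coe_add]; exact WithBot.coe_ne_bot)
    | coe g =>
      rw [← WithBot.coe_add, ← WithBot.coe_add, WithBot.coe_inj] at h
      have e := congrArg Subtype.val h
      simp only [ConvGerm.coe_add] at e
      congr 1
      apply Subtype.ext
      exact AffGerm.ext (add_right_cancel (congrArg AffGerm.x e)) (add_right_cancel (congrArg AffGerm.hp e))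
        (add_right_cancel (congrArg AffGerm.hm e))

/-- **Prop. 4.5, second part**: "its semifield of fractions `Frac ℛ_H` is the semifield of germs, at
`λ = 1`, of `ℝ_max`-valued, piecewise affine, continuous functions `f(λ)` with slopes in `H`" —
"The triples `(x,h₊,h₋)` obtained from elements of `Frac ℛ_H` correspond to arbitrary values of
`(x,h₊,h₋) ∈ ℝ × H × H`": every triple is a difference `g - k` of two convex ones.
[cite: ConnesConsani2017ScalingSite, Prop. 4.5] -/
theorem ConnesConsani2017_prop_4_5_frac (f : AffGerm H) : ∃ g k : ConvGerm H, f + k.1 = g.1 := by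
  set m : ℝ := max 0 (f.hm - f.hp) with hm
  have hmH : m ∈ H := by
    rcases max_choice 0 (f.hm - f.hp) with e | e <;> rw [hm, e]
    · exact H.zero_mem
    · exact H.sub_mem f.hm_mem f.hp_mem
  refine ⟨⟨⟨f.x, f.hp + m, f.hm, H.add_mem f.hp_mem hmH, f.hm_mem⟩, ?_⟩,
    ⟨⟨0, m, 0, hmH, H.zero_mem⟩, ?_⟩, ?_⟩
  · show f.hm ≤ f.hp + m
    have := le_max_right 0 (f.hm - f.hp); linarith
  · show (0 : ℝ) ≤ m
    exact le_max_left _ _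
  · exact AffGerm.ext (add_zero _) rfl (add_zero _)

/-- In `Frac ℛ_H` the `∨` of fractions is computed through (24): for `f = g - k`, `f' = g' - k'`
(`f + k = g`, `f' + k' = g'`) one has `(f ∨ f') + (k + k') = (g + k') ∨ (g' + k)` — the identity
"`(x-y) ∨ (z-t) = ((x+t) ∨ (y+z)) - (y+t)`". [cite: ConnesConsani2017ScalingSite, Prop. 4.5 (proof)] -/
theorem ConnesConsani2017_prop_4_5_sup (f f' g g' k k' : AffGerm H) (hf : f + k = g) (hf' : f' + k' = g') :
    (f ⊔ f') + (k + k') = (g + k') ⊔ (g' + k) := by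
  rw [AffGerm.sup_add, ← hf, ← hf', add_assoc, add_assoc f' k', add_comm k' k]

/-! ## The stalk `𝒵_H` at the degenerate point `𝔮_H` (Thm. 4.2 (ii)) and Lemma 4.4 (ii) -/

/-- **`𝒵_H`** (Thm. 4.2 (ii)): "the semiring associated by the max-plus construction to the
totally ordered group `ℝ × H` endowed with the lexicographic order" — `WithBot (ℝ ×ₗ H)` with
`∨ = ⊔` and product `+`. [cite: ConnesConsani2017ScalingSite, Thm. 4.2 (ii)] -/
abbrev ZStalk (H : AddSubgroup ℝ) : Type := WithBot (ℝ ×ₗ H)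

/-- The product rule "`(x,h) • (x',h') = (x + x', h + h')`". [cite: ConnesConsani2017ScalingSite, Thm. 4.2 (proof of (ii))] -/
theorem ZStalk.coe_add (x x' : ℝ) (h h' : H) :
    ((toLex (x, h) : ℝ ×ₗ H) : ZStalk H) + (toLex (x', h') : ℝ ×ₗ H) = ((toLex (x + x', h + h') : ℝ ×ₗ H) : ZStalk H) := by
  rw [← WithBot.coe_add, ← toLex_add, Prod.mk_add_mk]

/-- The addition rule "`(x,h) ∨ (x',h') := (x,h)` if `x > x'`; `(x',h')` if `x' > x`; `(x, h ∨ h')` if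
`x = x'`". [cite: ConnesConsani2017ScalingSite, Thm. 4.2 (proof of (ii))] -/
theorem ZStalk.sup_def (x x' : ℝ) (h h' : H) :
    (toLex (x, h) : ℝ ×ₗ H) ⊔ toLex (x', h') =
      if x' < x then toLex (x, h) else if x < x' then toLex (x', h') else toLex (x, max h h') := by
  rcases lt_trichotomy x x' with hlt | rfl | hgt
  · rw [if_neg (not_lt.2 hlt.le), if_pos hlt]
    exact sup_eq_right.2 (Prod.Lex.toLex_le_toLex.2 (Or.inl hlt))
  · rw [if_neg (lt_irrefl _), if_neg (lt_irrefl _)]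
    rcases le_total h h' with hle | hle
    · rw [max_eq_right hle]; exact sup_eq_right.2 (Prod.Lex.toLex_le_toLex.2 (Or.inr ⟨rfl, hle⟩))
    · rw [max_eq_left hle]; exact sup_eq_left.2 (Prod.Lex.toLex_le_toLex.2 (Or.inr ⟨rfl, hle⟩))
  · rw [if_pos hgt]
    exact sup_eq_left.2 (Prod.Lex.toLex_le_toLex.2 (Or.inl hgt))

/-- The evaluation `(x,h) ↦ x`, `-∞ ↦ -∞`: `𝒵_H → ℝ_max`. [cite: ConnesConsani2017ScalingSite, Lemma 4.4 (ii)] -/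
def ZStalk.eval : ZStalk H → WithBot ℝ := WithBot.map fun u => (ofLex u).1

/-- The constants `ℝ_max → 𝒵_H`, `c ↦ (c, 0)`. [cite: ConnesConsani2017ScalingSite, Lemma 4.4 (ii)] -/
def ZStalk.const : WithBot ℝ → ZStalk H := WithBot.map fun c => toLex (c, 0)

/-- `eval ∘ const = id`. [cite: ConnesConsani2017ScalingSite, Lemma 4.4 (ii)] -/
@[simp] theorem ZStalk.eval_const (c : WithBot ℝ) : ZStalk.eval (ZStalk.const c : ZStalk H) = c := by
  induction c using WithBot.recBotCoe with
  | bot => rfl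
  | coe c => rfl

/-- `eval` on `𝒵_H` preserves `∨`. [cite: ConnesConsani2017ScalingSite, Lemma 4.4 (ii)] -/
theorem ZStalk.eval_sup (a b : ZStalk H) : ZStalk.eval (a ⊔ b) = ZStalk.eval a ⊔ ZStalk.eval b := by
  induction a using WithBot.recBotCoe with
  | bot => simp [ZStalk.eval]
  | coe u =>
    induction b using WithBot.recBotCoe with
    | bot => simp [ZStalk.eval]
    | coe v =>
      simp only [ZStalk.eval, ← WithBot.coe_sup, WithBot.map_coe]
      congr 1
      -- the first coordinate of a lexicographic max is the max of first coordinates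
      rcases le_total u v with huv | huv
      · rw [sup_eq_right.2 huv, eq_comm, max_eq_right_iff]
        rcases Prod.Lex.toLex_le_toLex.1 (show toLex (ofLex u) ≤ toLex (ofLex v) from huv) with h | ⟨h, -⟩
        · exact h.le
        · exact h.le
      · rw [sup_eq_left.2 huv, eq_comm, max_eq_left_iff]
        rcases Prod.Lex.toLex_le_toLex.1 (show toLex (ofLex v) ≤ toLex (ofLex u) from huv) with h | ⟨h, -⟩
        · exact h.le
        · exact h.le

/-- `eval` on `𝒵_H` preserves the product. [cite: ConnesConsani2017ScalingSite, Lemma 4.4 (ii)] -/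
theorem ZStalk.eval_add (a b : ZStalk H) : ZStalk.eval (a + b) = ZStalk.eval a + ZStalk.eval b := by
  induction a using WithBot.recBotCoe with
  | bot => simp [ZStalk.eval]
  | coe u =>
    induction b using WithBot.recBotCoe with
    | bot => simp [ZStalk.eval]
    | coe v =>
      simp only [ZStalk.eval, ← WithBot.coe_add, WithBot.map_coe, ofLex_add, Prod.fst_add]

/-- **Connes–Consani 2017, Lemma 4.4 (ii)**: "The map `(x, h₊) ↦ x` is the only element of
`Hom_{ℝ_max}(𝒵_H, ℝ_max)`" ("The proof is similar as for (i)"). [cite: ConnesConsani2017ScalingSite, Lemma 4.4 (ii)] -/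
theorem ConnesConsani2017_lemma_4_4_ii (φ : ZStalk H → WithBot ℝ)
    (hsup : ∀ a b, φ (a ⊔ b) = φ a ⊔ φ b) (hconst : ∀ c : ℝ, φ (ZStalk.const c) = c) :
    φ = ZStalk.eval := by
  have hmono : ∀ a b : ZStalk H, a ≤ b → φ a ≤ φ b := fun a b hab => by
    rw [← sup_eq_right.2 hab, hsup]; exact le_sup_left
  funext a
  induction a using WithBot.recBotCoe with
  | bot =>
    by_contra hne
    obtain ⟨y, hy⟩ := WithBot.ne_bot_iff_exists.1 hne
    have := hmono ⊥ (ZStalk.const ((y - 1 : ℝ) : WithBot ℝ)) bot_le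
    rw [hconst, ← hy] at this
    have := WithBot.coe_le_coe.1 this
    linarith
  | coe u =>
    show φ u = ((ofLex u).1 : WithBot ℝ)
    set x := (ofLex u).1 with hx
    have hbounds : ∀ ε : ℝ, 0 < ε → ((x - ε : ℝ) : WithBot ℝ) ≤ φ u ∧ φ u ≤ ((x + ε : ℝ) : WithBot ℝ) := by
      intro ε hε
      have h1 : (ZStalk.const (x - ε) : ZStalk H) ≤ u := by
        have : toLex (x - ε, (0 : H)) ≤ toLex (ofLex u) :=
          Prod.Lex.toLex_le_toLex.2 (Or.inl (by simp [hx]; linarith))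
        exact WithBot.coe_le_coe.2 this
      have h2 : (u : ZStalk H) ≤ ZStalk.const (x + ε) := by
        have : toLex (ofLex u) ≤ toLex (x + ε, (0 : H)) :=
          Prod.Lex.toLex_le_toLex.2 (Or.inl (by simp [hx]; linarith))
        exact WithBot.coe_le_coe.2 this
      exact ⟨by rw [← hconst]; exact hmono _ _ h1, by rw [← hconst]; exact hmono _ _ h2⟩
    have hne : φ u ≠ ⊥ := fun h0 => by
      have := (hbounds 1 one_pos).1; rw [h0] at this; exact WithBot.not_coe_le_bot _ this
    obtain ⟨y, hy⟩ := WithBot.ne_bot_iff_exists.1 hne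
    rw [← hy]
    congr 1
    by_contra hyx
    rcases lt_or_gt_of_ne hyx with hlt | hlt
    · have := (hbounds ((x - y) / 2) (by linarith)).1
      rw [← hy, WithBot.coe_le_coe] at this
      linarith
    · have := (hbounds ((y - x) / 2) (by linarith)).2
      rw [← hy, WithBot.coe_le_coe] at this
      linarith

end Literature.NumberTheory.ConnesConsani
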